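import Summits.Ventures.LatticeQCDFlow.Scoring.SU2TorusWilsonLoopCharacterIntegral
import Summits.Ventures.LatticeQCDFlow.Scoring.SU2TorusPartitionFunction
import Summits.Ventures.LatticeQCDFlow.Scoring.SU2PlaquetteSeriesFubiniWeighted
import Summits.Ventures.LatticeQCDFlow.Scoring.SU2TorusPlaquetteFiniteVolume
import HarnessLib

/-!
# SU(2) with FREE boundary: on an open `R₀ × T₀` rectangle every Wilson loop is EXACTLY `(I₂(2β)/I₁(2β))^{area}` — the Gross–Witten / Migdal independence of plaquettes

HONEST FRAMING: exact (Metropolis-corrected) sampling algorithms for lattice gauge theory;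
figures of merit are autocorrelation/cost numbers at stated couplings and volumes; no
continuum-physics claim.

Venture `LatticeQCDFlow` (cell pub-lqcd), sub-topic `Scoring`; FANOUT row 5 (`s0-sun-a`), GEN-12.
NEW WORK of the cell (placement rule); the lead's NOT-TYPED item 'open-boundary formulas' for SU(2).
The OPEN `R₀ × T₀` lattice (free boundary) is realised inside the torus `(ℤ/L)²` (`R₀, T₀ ≤ L − 1`): its
links are the links of the plaquettes `B = {(i+a, j+b) : a < R₀, b < T₀}`, its Wilson weight is
`w_B(V) = ∏_{x ∈ B} e^{−β(2 − 2·½tr U_x)}` (theory-2's SU(2) plaquette Boltzmann factor, on the plaquettes of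
`B` ONLY), and its expectations are `∫ F w_B dHaar^{⊗E} / ∫ w_B dHaar^{⊗E}` over ALL torus links — for `F`
depending on the rectangle's links only this IS the free-boundary Wilson measure of the rectangle (the
remaining links are independent Haar dummies).  With `c_n(β) = e^{−2β}(I_n(2β) − I_{n+2}(2β))`:

* **`integral_openWeight_su2_two`** — `∫ w_B dHaar^{⊗E} = c_0(β)^{R₀T₀}`: the open-lattice partition function
  FACTORISES (`c_0 = e^{−2β} I₁(2β)/β`);
* **`integral_su2a0_loop_mul_openWeight_two`** — for ANY loop `W_{R×T}` (corner `(i', j')`) whose plaquettes lie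
  in `B` (`rect_subset_rect`: e.g. the rectangle's own corner with `R ≤ R₀`, `T ≤ T₀`):
  `∫ ½tr W_{R×T} · w_B dHaar^{⊗E} = (c_1/2)^{RT} c_0^{R₀T₀ − RT}`;
* **`open_wilson_mean_su2a0_loop_two`** — THE EXACT FREE-BOUNDARY AREA LAW:
  `⟨½ tr W_{R×T}⟩_{open R₀×T₀, β} = (c_1/(2c_0))^{RT} = (I₂(2β)/I₁(2β))^{RT}` for EVERY size of the
  surrounding rectangle and EVERY position of the loop inside it — no finite-size or boundary correction
  at all, although the free boundary breaks translation invariance (contrast the torus: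
  `SU2TorusWilsonLoopsFiniteVolume`, correction `O(r^{L²−RT})`); `RT = 1`: the open-lattice plaquette is
  exactly the one-plaquette value `I₂(2β)/I₁(2β)` of the reference table's infinite-volume column.

Method: expand `w_B` in characters plaquette by plaquette (`integral_mul_prod_plaqWeight_eq_tsum_fintype`),
extend each assignment `x : B → ℕ` by `0` off `B` (`χ_0 = 1`), and evaluate with the FULL-TORUS character
integrals of GEN-10/11 (`integral_prod_su2Character_plaquettes`, `integral_su2a0_loop_mul_prod_su2Character`):
a plaquette outside `B` carries representation `0`, so constancy forces the trivial assignment (partition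
function) or `𝟙_{loop region}` (numerator).  Nothing is cited; no `def`.
-/

noncomputable section

open Real MeasureTheory Set Function Finset Polynomial.Chebyshev
open Literature.MathematicalPhysics.QuantumFieldTheory Literature.MathematicalPhysics.QuantumLattice
open Literature.Analysis.FunctionSpaces
open Summit.Ventures.LatticeQCDFlow.Exactness
open Summit.Ventures.LatticeQCDFlow.Theory2.Lattice

namespace Summit.Ventures.LatticeQCDFlow.Scoring

variable {L : ℕ} [NeZero L]

/-! ## §1. Assignments on a set of plaquettes, extended by zero -/

/-- Extending an assignment on `B` by `0`: the character product over all plaquettes equals the product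
over `B` (`χ_0 = 1`). -/
theorem prod_su2Character_extend (B : Finset (Site 2 L)) (x : ↥B → ℕ) (t : Site 2 L → ℝ) :
    ∏ s : Site 2 L, (U ℝ ((fun s : Site 2 L => if h : s ∈ B then x ⟨s, h⟩ else 0) s)).eval (t s) =
      ∏ p : ↥B, (U ℝ (x p)).eval (t p) := by
  rw [← Finset.prod_mul_prod_compl B, ← Finset.prod_coe_sort B]
  have h2 : ∏ s ∈ Bᶜ, (U ℝ ((fun s : Site 2 L => if h : s ∈ B then x ⟨s, h⟩ else 0) s)).eval (t s) = 1 := by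
    refine Finset.prod_eq_one fun s hs => ?_
    have hs' : s ∉ B := Finset.mem_compl.mp hs
    simp [dif_neg hs']
  rw [h2, mul_one]
  refine Finset.prod_congr rfl fun p _ => ?_
  simp

omit [NeZero L] in
/-- The extension by zero is constant only if the assignment vanishes, provided some plaquette lies
outside `B`. -/
theorem extend_const_iff (B : Finset (Site 2 L)) {s₀ : Site 2 L} (hs₀ : s₀ ∉ B) (x : ↥B → ℕ) :
    (∀ s : Site 2 L, (fun s : Site 2 L => if h : s ∈ B then x ⟨s, h⟩ else 0) s =
      (fun s : Site 2 L => if h : s ∈ B then x ⟨s, h⟩ else 0) 0) ↔ x = 0 := by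
  constructor
  · intro h
    funext p
    have h1 := h p
    have h0 := h s₀
    simp only [dif_pos p.2, dif_neg hs₀] at h1 h0
    rw [h1, ← h0]
    rfl
  · intro hx s
    subst hx
    simp

/-! ## §2. The open rectangle inside the torus -/

section Rect

variable (i j : ZMod L) (R₀ T₀ : ℕ)

omit [NeZero L] in
/-- A site outside the rectangle `B = {(i+a, j+b) : a < R₀, b < T₀}` when `R₀ ≤ L − 1`: `(i + (L−1), j)`. -/
theorem outside_rect (hR₀ : R₀ + 1 ≤ L) :
    (![i + ((L - 1 : ℕ) : ZMod L), j] : Site 2 L) ∉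
      (range R₀ ×ˢ range T₀).image (fun p : ℕ × ℕ => (![i + p.1, j + p.2] : Site 2 L)) := by
  intro h
  obtain ⟨⟨a, b⟩, hab, he⟩ := Finset.mem_image.mp h
  rw [Finset.mem_product, Finset.mem_range, Finset.mem_range] at hab
  have h1 := (vec2_eq_iff.mp he).1
  exact natCast_zmod_ne_of_lt (L := L) (by omega) (by omega) (by omega) (add_left_cancel h1)

omit [NeZero L] in
/-- A smaller rectangle with the same corner lies inside. -/
theorem rect_subset_rect {R T : ℕ} (hR : R ≤ R₀) (hT : T ≤ T₀) :
    (range R ×ˢ range T).image (fun p : ℕ × ℕ => (![i + p.1, j + p.2] : Site 2 L)) ⊆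
      (range R₀ ×ˢ range T₀).image (fun p : ℕ × ℕ => (![i + p.1, j + p.2] : Site 2 L)) := by
  intro s hs
  obtain ⟨⟨a, b⟩, hab, he⟩ := Finset.mem_image.mp hs
  rw [Finset.mem_product, Finset.mem_range, Finset.mem_range] at hab
  exact Finset.mem_image.mpr ⟨(a, b), Finset.mem_product.mpr ⟨Finset.mem_range.mpr (by omega),
    Finset.mem_range.mpr (by omega)⟩, he⟩

end Rect

/-! ## §3. The open-lattice partition function factorises -/

/-- **THE FREE-BOUNDARY PARTITION FUNCTION FACTORISES**: for `R₀ + 1 ≤ L` (and any `T₀ ≤ L`), `β ≥ 0`,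
`∫ ∏_{x ∈ B} e^{−β(2 − 2·½tr U_x)} dHaar^{⊗E} = c_0(β)^{#B}`, `B` the `R₀ × T₀` rectangle of plaquettes with
corner `(i, j)`, `c_0(β) = e^{−2β}(I_0(2β) − I_2(2β))`. -/
theorem integral_openWeight_su2_two {β : ℝ} (hβ : 0 ≤ β) (i j : ZMod L) {R₀ T₀ : ℕ} (hR₀ : R₀ + 1 ≤ L) :
    ∫ V, ∏ p : ↥((range R₀ ×ˢ range T₀).image (fun p : ℕ × ℕ => (![i + p.1, j + p.2] : Site 2 L))),
        Real.exp (-(β * (2 - 2 * su2a0 (plaquetteHolonomy V (p : Site 2 L) 0 1))))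
        ∂(Measure.pi fun _ : Edge 2 L => haarProbability (Matrix.specialUnitaryGroup (Fin 2) ℂ)) =
      (Real.exp (-(2 * β)) * (besselI 0 (2 * β) - besselI 2 (2 * β))) ^
        ((range R₀ ×ˢ range T₀).image (fun p : ℕ × ℕ => (![i + p.1, j + p.2] : Site 2 L))).card := by
  haveI := secondCountableTopology_su2
  set B := (range R₀ ×ˢ range T₀).image (fun p : ℕ × ℕ => (![i + p.1, j + p.2] : Site 2 L)) with hB
  set μH := (Measure.pi fun _ : Edge 2 L => haarProbability (Matrix.specialUnitaryGroup (Fin 2) ℂ)) with hμH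
  have ham : ∀ p : ↥B, Measurable fun V : GaugeConfig 2 L (Matrix.specialUnitaryGroup (Fin 2) ℂ) =>
      su2a0 (plaquetteHolonomy V (p : Site 2 L) 0 1) :=
    fun p => continuous_su2a0.measurable.comp (TwoDim.measurable_plaquetteHolonomy (p : Site 2 L))
  have ha : ∀ (p : ↥B) (V : GaugeConfig 2 L (Matrix.specialUnitaryGroup (Fin 2) ℂ)),
      su2a0 (plaquetteHolonomy V (p : Site 2 L) 0 1) ∈ Icc (-1 : ℝ) 1 :=
    fun p V => abs_le.mp (abs_su2a0_le_one _)
  obtain ⟨_, h⟩ := integral_mul_prod_plaqWeight_eq_tsum_fintype μH hβ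
    (fun (p : ↥B) (V : GaugeConfig 2 L (Matrix.specialUnitaryGroup (Fin 2) ℂ)) =>
      su2a0 (plaquetteHolonomy V (p : Site 2 L) 0 1)) ham ha (fun _ => (1 : ℝ)) measurable_const
      (fun _ => by simp)
  simp only [one_mul] at h
  rw [h]
  -- each term: the full-torus character integral of the extension by zero
  have hs₀ := outside_rect i j R₀ T₀ hR₀
  have hterm : ∀ x : ↥B → ℕ,
      (∏ p, Real.exp (-(2 * β)) * (besselI (x p) (2 * β) - besselI (x p + 2) (2 * β))) *
        ∫ V, ∏ p : ↥B, (U ℝ (x p)).eval (su2a0 (plaquetteHolonomy V (p : Site 2 L) 0 1)) ∂μH =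
      if x = 0 then (Real.exp (-(2 * β)) * (besselI 0 (2 * β) - besselI 2 (2 * β))) ^ B.card else 0 := by
    intro x
    have hext : (fun V : GaugeConfig 2 L (Matrix.specialUnitaryGroup (Fin 2) ℂ) =>
        ∏ p : ↥B, (U ℝ (x p)).eval (su2a0 (plaquetteHolonomy V (p : Site 2 L) 0 1))) =
        fun V => ∏ s : Site 2 L, (U ℝ ((fun s : Site 2 L => if h : s ∈ B then x ⟨s, h⟩ else 0) s)).eval
          (su2a0 (plaquetteHolonomy V s 0 1)) := by
      funext V
      rw [prod_su2Character_extend]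
    rw [hext, hμH, integral_prod_su2Character_plaquettes]
    by_cases hx : x = 0
    · subst hx
      rw [if_pos (fun s => by simp), if_pos rfl]
      simp [Finset.prod_const]
    · rw [if_neg (fun hc => hx ((extend_const_iff B hs₀ x).mp hc)), if_neg hx, mul_zero]
  simp_rw [hterm]
  exact tsum_ite_eq 0 _

/-! ## §4. The loop numerator -/

/-- **THE FREE-BOUNDARY LOOP NUMERATOR**: for a loop `W_{R×T}` with corner `(i', j')`, `1 ≤ R, T ≤ L`, whose
region lies in the rectangle `B` (`R₀ + 1 ≤ L`), `β ≥ 0`: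
`∫ ½tr W_{R×T} · ∏_{x ∈ B} e^{−β(2−2·½tr U_x)} dHaar^{⊗E} = (c_1/2)^{RT} · c_0^{#B − RT}` — only the
assignment `𝟙_{R×T}` survives. -/
theorem integral_su2a0_loop_mul_openWeight_two {β : ℝ} (hβ : 0 ≤ β) (i j : ZMod L) {R₀ T₀ : ℕ}
    (hR₀ : R₀ + 1 ≤ L) (i' j' : ZMod L) {R T : ℕ} (hR : 1 ≤ R) (hRL : R ≤ L) (hT : 1 ≤ T) (hTL : T ≤ L)
    (hsub : (range R ×ˢ range T).image (fun p : ℕ × ℕ => (![i' + p.1, j' + p.2] : Site 2 L)) ⊆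
      (range R₀ ×ˢ range T₀).image (fun p : ℕ × ℕ => (![i + p.1, j + p.2] : Site 2 L))) :
    ∫ V, su2a0 (((List.range R).map fun a : ℕ => V (![i' + a, j'], 0)).prod *
            ((List.range T).map fun b : ℕ => V (![i' + R, j' + b], 1)).prod *
            (((List.range R).map fun a : ℕ => V (![i' + a, j' + T], 0)).prod)⁻¹ *
            (((List.range T).map fun b : ℕ => V (![i', j' + b], 1)).prod)⁻¹) *
        ∏ p : ↥((range R₀ ×ˢ range T₀).image (fun p : ℕ × ℕ => (![i + p.1, j + p.2] : Site 2 L))),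
          Real.exp (-(β * (2 - 2 * su2a0 (plaquetteHolonomy V (p : Site 2 L) 0 1))))
        ∂(Measure.pi fun _ : Edge 2 L => haarProbability (Matrix.specialUnitaryGroup (Fin 2) ℂ)) =
      (Real.exp (-(2 * β)) * (besselI 1 (2 * β) - besselI 3 (2 * β)) / 2) ^ (R * T) *
        (Real.exp (-(2 * β)) * (besselI 0 (2 * β) - besselI 2 (2 * β))) ^
          (((range R₀ ×ˢ range T₀).image (fun p : ℕ × ℕ => (![i + p.1, j + p.2] : Site 2 L))).card - R * T) := by
  haveI := secondCountableTopology_su2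
  set B := (range R₀ ×ˢ range T₀).image (fun p : ℕ × ℕ => (![i + p.1, j + p.2] : Site 2 L)) with hB
  set A := (range R ×ˢ range T).image (fun p : ℕ × ℕ => (![i' + p.1, j' + p.2] : Site 2 L)) with hA
  set μH := (Measure.pi fun _ : Edge 2 L => haarProbability (Matrix.specialUnitaryGroup (Fin 2) ℂ)) with hμH
  set c : ℕ → ℝ := fun n => Real.exp (-(2 * β)) * (besselI n (2 * β) - besselI (n + 2) (2 * β)) with hc
  have hAB : A ⊆ B := hsub
  have hs₀B : (![i + ((L - 1 : ℕ) : ZMod L), j] : Site 2 L) ∉ B := outside_rect i j R₀ T₀ hR₀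
  have hs₀A : (![i + ((L - 1 : ℕ) : ZMod L), j] : Site 2 L) ∉ A := fun h => hs₀B (hAB h)
  have hcardA : A.card = R * T := card_rectSites i' j' hRL hTL
  have ham : ∀ p : ↥B, Measurable fun V : GaugeConfig 2 L (Matrix.specialUnitaryGroup (Fin 2) ℂ) =>
      su2a0 (plaquetteHolonomy V (p : Site 2 L) 0 1) :=
    fun p => continuous_su2a0.measurable.comp (TwoDim.measurable_plaquetteHolonomy (p : Site 2 L))
  have ha : ∀ (p : ↥B) (V : GaugeConfig 2 L (Matrix.specialUnitaryGroup (Fin 2) ℂ)),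
      su2a0 (plaquetteHolonomy V (p : Site 2 L) 0 1) ∈ Icc (-1 : ℝ) 1 :=
    fun p V => abs_le.mp (abs_su2a0_le_one _)
  -- the loop observable
  set W : GaugeConfig 2 L (Matrix.specialUnitaryGroup (Fin 2) ℂ) → Matrix.specialUnitaryGroup (Fin 2) ℂ :=
    fun V => ((List.range R).map fun a : ℕ => V (![i' + a, j'], 0)).prod *
      ((List.range T).map fun b : ℕ => V (![i' + R, j' + b], 1)).prod *
      (((List.range R).map fun a : ℕ => V (![i' + a, j' + T], 0)).prod)⁻¹ *
      (((List.range T).map fun b : ℕ => V (![i', j' + b], 1)).prod)⁻¹ with hW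
  have hWc : Continuous W := by
    refine ((Continuous.mul (Continuous.mul ?_ ?_) (Continuous.inv ?_)).mul (Continuous.inv ?_)) <;>
      exact continuous_list_prod _ fun k _ => continuous_apply _
  have hgm : Measurable fun V => su2a0 (W V) := (continuous_su2a0.comp hWc).measurable
  obtain ⟨_, h⟩ := integral_mul_prod_plaqWeight_eq_tsum_fintype μH hβ
    (fun (p : ↥B) (V : GaugeConfig 2 L (Matrix.specialUnitaryGroup (Fin 2) ℂ)) =>
      su2a0 (plaquetteHolonomy V (p : Site 2 L) 0 1)) ham ha (fun V => su2a0 (W V)) hgm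
      (fun V => abs_su2a0_le_one _)
  rw [h]
  -- the surviving assignment
  set x₁ : ↥B → ℕ := fun p => if (p : Site 2 L) ∈ A then 1 else 0 with hx₁
  have hterm : ∀ x : ↥B → ℕ,
      (∏ p, Real.exp (-(2 * β)) * (besselI (x p) (2 * β) - besselI (x p + 2) (2 * β))) *
        ∫ V, su2a0 (W V) * ∏ p : ↥B, (U ℝ (x p)).eval (su2a0 (plaquetteHolonomy V (p : Site 2 L) 0 1)) ∂μH =
      if x = x₁ then (c 1 / 2) ^ (R * T) * c 0 ^ (B.card - R * T) else 0 := by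
    intro x
    obtain ⟨m, hm⟩ : ∃ m : Site 2 L → ℕ, m = fun s => if h : s ∈ B then x ⟨s, h⟩ else 0 := ⟨_, rfl⟩
    have hmv : ∀ s, m s = if h : s ∈ B then x ⟨s, h⟩ else 0 := fun s => by rw [hm]
    have hext : (fun V : GaugeConfig 2 L (Matrix.specialUnitaryGroup (Fin 2) ℂ) =>
        su2a0 (W V) * ∏ p : ↥B, (U ℝ (x p)).eval (su2a0 (plaquetteHolonomy V (p : Site 2 L) 0 1))) =
        fun V => su2a0 (W V) * ∏ s : Site 2 L, (U ℝ (m s)).eval (su2a0 (plaquetteHolonomy V s 0 1)) := by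
      funext V
      rw [hm, prod_su2Character_extend]
    rw [hext, hW, hμH, integral_su2a0_loop_mul_prod_su2Character i' j' hR hRL hT hTL m, ← hA]
    -- the value of `m` at the corner and outside
    have hm0 : m ![i + ((L - 1 : ℕ) : ZMod L), j] = 0 := by rw [hmv, dif_neg hs₀B]
    -- the `μ + 1` branch never fires (the outside plaquette carries `0`)
    have hbr1 : ¬ (∀ s, s ∉ A → m s = m ![i', j'] + 1) := fun hall => by
      have := hall _ hs₀A
      rw [hm0] at this
      omega
    simp only [if_neg hbr1, mul_zero]
    by_cases hx : x = x₁
    · -- the surviving term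
      have hmA : ∀ s, s ∈ A → m s = 1 := fun s hs => by
        rw [hmv, dif_pos (hAB hs), hx, hx₁]
        simp [hs]
      have hmAc : ∀ s, s ∉ A → m s = 0 := fun s hs => by
        rw [hmv]
        by_cases hsB : s ∈ B
        · rw [dif_pos hsB, hx, hx₁]
          simp [hs]
        · rw [dif_neg hsB]
      have hcorner : (![i', j'] : Site 2 L) ∈ A := by
        have h00 := mem_rect i' j' (R := R) (T := T) (a := 0) (b := 0) (by omega) (by omega)
        simp only [Nat.cast_zero, add_zero] at h00
        exact h00
      have hμ : m ![i', j'] = 1 := hmA _ hcorner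
      have houter : ∀ a < R, ∀ b < T, m ![i' + a, j' + b] = m ![i', j'] := fun a ha b hb => by
        rw [hμ, hmA _ (mem_rect i' j' ha hb)]
      rw [if_pos houter, hμ, if_neg one_ne_zero, if_pos (fun s hs => by rw [hmAc s hs]), if_pos hx, hx]
      -- the weight `∏_p c(x₁ p) = c 1 ^ #A * c 0 ^ (#B − #A)`
      have hw : ∏ p : ↥B, Real.exp (-(2 * β)) * (besselI (x₁ p) (2 * β) - besselI (x₁ p + 2) (2 * β)) =
          c 1 ^ (R * T) * c 0 ^ (B.card - R * T) := by
        have h1 : ∏ p : ↥B, Real.exp (-(2 * β)) * (besselI (x₁ p) (2 * β) - besselI (x₁ p + 2) (2 * β)) =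
            ∏ s ∈ B, (if s ∈ A then c 1 else c 0) := by
          rw [← Finset.prod_coe_sort B]
          refine Finset.prod_congr rfl fun p _ => ?_
          rw [hx₁, hc]
          by_cases hp : (p : Site 2 L) ∈ A
          · simp only [hp, if_true]
          · simp only [hp, if_false]
        rw [h1, Finset.prod_ite, Finset.prod_const, Finset.prod_const, Finset.filter_not,
          Finset.filter_mem_eq_inter, Finset.inter_eq_right.mpr hAB, Finset.card_sdiff_of_subset hAB, hcardA]
      have h2 : ((1 : ℝ) / 2) ^ (R * T) = (1 / 2) ^ (R * T - 1) * (1 / 2) := by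
        rw [← pow_succ, Nat.sub_add_cancel (Nat.mul_pos hR hT)]
      have h3 : (c 1 / 2) ^ (R * T) = c 1 ^ (R * T) * ((1 / 2) ^ (R * T - 1) * (1 / 2)) := by
        rw [← h2, div_pow, div_pow, one_pow, div_eq_mul_one_div]
      rw [hw, h3]
      push_cast
      ring
    · -- every other assignment dies
      rw [if_neg hx]
      by_cases houter : ∀ a < R, ∀ b < T, m ![i' + a, j' + b] = m ![i', j']
      · rw [if_pos houter]
        by_cases hμ0 : m ![i', j'] = 0
        · rw [if_pos hμ0]; ring
        · rw [if_neg hμ0]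
          by_cases hbr2 : ∀ s, s ∉ A → m s = m ![i', j'] - 1
          · -- then `m ![i',j'] = 1`, `m = 1` on `A`, `0` off `A`: `x = x₁`, contradiction
            exfalso
            have h1 : m ![i', j'] = 1 := by have := hbr2 _ hs₀A; rw [hm0] at this; omega
            apply hx
            funext p
            by_cases hp : (p : Site 2 L) ∈ A
            · obtain ⟨⟨a, b⟩, hab, he⟩ := Finset.mem_image.mp hp
              rw [Finset.mem_product, Finset.mem_range, Finset.mem_range] at hab
              have h2 := houter a hab.1 b hab.2
              rw [he, h1, hmv, dif_pos p.2] at h2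
              rw [hx₁]
              simp only [if_pos hp]
              exact h2
            · have h2 := hbr2 _ hp
              rw [h1, hmv, dif_pos p.2] at h2
              rw [hx₁]
              simp only [if_neg hp]
              exact h2
          · rw [if_neg hbr2]; ring
      · rw [if_neg houter, mul_zero]
  simp_rw [hterm]
  rw [tsum_ite_eq x₁ _]

/-! ## §5. The exact free-boundary area law -/

/-- **THE EXACT FREE-BOUNDARY AREA LAW OF TWO-DIMENSIONAL SU(2) LATTICE YANG–MILLS.**  For `β > 0`, an open
`R₀ × T₀` rectangle of plaquettes (`R₀ + 1 ≤ L`, realised inside the torus `(ℤ/L)²`, Wilson weight on its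
plaquettes only) and ANY Wilson loop `W_{R×T}` (corner `(i', j')`, `1 ≤ R, T ≤ L`) whose plaquettes lie in the
rectangle: `∫ ½tr W_{R×T} w_B dHaar^{⊗E} / ∫ w_B dHaar^{⊗E} = (I₂(2β)/I₁(2β))^{RT}` — EXACTLY, for every size
of the surrounding open lattice and every position of the loop: the plaquettes of a free-boundary 2-d
lattice are independent one-plaquette variables (Gross–Witten, Migdal), and the infinite-volume column of
the cell's reference table is exact for open boundaries. -/
theorem open_wilson_mean_su2a0_loop_two {β : ℝ} (hβ : 0 < β) (i j : ZMod L) {R₀ T₀ : ℕ}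
    (hR₀ : R₀ + 1 ≤ L) (i' j' : ZMod L) {R T : ℕ} (hR : 1 ≤ R) (hRL : R ≤ L) (hT : 1 ≤ T) (hTL : T ≤ L)
    (hsub : (range R ×ˢ range T).image (fun p : ℕ × ℕ => (![i' + p.1, j' + p.2] : Site 2 L)) ⊆
      (range R₀ ×ˢ range T₀).image (fun p : ℕ × ℕ => (![i + p.1, j + p.2] : Site 2 L))) :
    (∫ V, su2a0 (((List.range R).map fun a : ℕ => V (![i' + a, j'], 0)).prod *
            ((List.range T).map fun b : ℕ => V (![i' + R, j' + b], 1)).prod *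
            (((List.range R).map fun a : ℕ => V (![i' + a, j' + T], 0)).prod)⁻¹ *
            (((List.range T).map fun b : ℕ => V (![i', j' + b], 1)).prod)⁻¹) *
        ∏ p : ↥((range R₀ ×ˢ range T₀).image (fun p : ℕ × ℕ => (![i + p.1, j + p.2] : Site 2 L))),
          Real.exp (-(β * (2 - 2 * su2a0 (plaquetteHolonomy V (p : Site 2 L) 0 1))))
        ∂(Measure.pi fun _ : Edge 2 L => haarProbability (Matrix.specialUnitaryGroup (Fin 2) ℂ))) /
      (∫ V, ∏ p : ↥((range R₀ ×ˢ range T₀).image (fun p : ℕ × ℕ => (![i + p.1, j + p.2] : Site 2 L))),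
          Real.exp (-(β * (2 - 2 * su2a0 (plaquetteHolonomy V (p : Site 2 L) 0 1))))
        ∂(Measure.pi fun _ : Edge 2 L => haarProbability (Matrix.specialUnitaryGroup (Fin 2) ℂ))) =
      (besselI 2 (2 * β) / besselI 1 (2 * β)) ^ (R * T) := by
  rw [integral_su2a0_loop_mul_openWeight_two hβ.le i j hR₀ i' j' hR hRL hT hTL hsub,
    integral_openWeight_su2_two hβ.le i j hR₀]
  set N := ((range R₀ ×ˢ range T₀).image (fun p : ℕ × ℕ => (![i + p.1, j + p.2] : Site 2 L))).card with hN
  have hRT : R * T ≤ N := by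
    rw [hN, ← card_rectSites i' j' hRL hTL]
    exact Finset.card_le_card hsub
  -- `c_0 = e^{−2β} I₁/β > 0`, `c_1/2 = e^{−2β} I₂/β`
  have h0 := charCoeff_div_succ_eq_besselI 0 hβ.ne'
  have h1 := charCoeff_div_succ_eq_besselI 1 hβ.ne'
  simp only [Nat.cast_zero, zero_add, div_one, Nat.cast_one] at h0 h1
  norm_num at h0 h1
  have hI1 : 0 < besselI 1 (2 * β) := besselI_pos 1 (by linarith)
  have he : 0 < Real.exp (-(2 * β)) := Real.exp_pos _
  have hc0 : Real.exp (-(2 * β)) * (besselI 0 (2 * β) - besselI 2 (2 * β)) ≠ 0 := by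
    rw [h0]; positivity
  obtain ⟨k, hk⟩ : ∃ k, N = R * T + k := ⟨N - R * T, by omega⟩
  rw [hk, Nat.add_sub_cancel_left, pow_add, mul_div_mul_right _ _ (pow_ne_zero _ hc0), ← div_pow, h1, h0]
  congr 1
  field_simp

end Summit.Ventures.LatticeQCDFlow.Scoring
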